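import Summits.BirchSwinnertonDyer.BirchSwinnertonDyer.Theorems.ByReductionTypeAtTwoOrdKatoHalfAtTwoIsoConjATwoOfPointFieldMu
import Literature.NumberTheory.IwasawaTheory.ClassicalMuVanishesAdjoinIOfNarrowDefectLayerOne
import HarnessLib

/-!
# Route `ByReductionTypeAtTwo` (rung K4), crux C1″ `FineSelmerConjAAtTwoAdditivePotGood` (item stmt-BirchSwinnertonDyer-22615):
# THE NARROW-DEFECT DOOR — (A)₂ for a curve whose `2`-torsion point field `ℚ(P)` is TOTALLY REAL (odd degree, odd `h`, one prime
# above `2`) from ONE unit-signature equality `#(U⁺/U²)(ℚ(P)·ℚ_1) = #(U⁺/U²)(ℚ(P))` — NO Lim fact, NO Ferrero–Washington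
# (a `--supports 22615` file; seat `bsd-2adic-k4-w1` GEN 9, successor key (i) of GEN 8: «a KERNEL road at REAL carriers»)

HONEST FRAMING (cell `bsd-2adic`, D-0036/D-0054/D-0152): THEOREMS ONLY (no definition, no named fact, no `sorry`); PROVED OUTRIGHT,
conditional only on KERNEL-decidable data of the point field `E = ℚ(P)` and of its first cyclotomic layer `E·ℚ_1 = E(√2)` (class number
parity, splitting of `2`, and the counts `#(U⁺/U²)` = totally positive units modulo squares, i.e. unit signatures). Closes nothing at the
`∀`-level (C1″ 22615 research-open); nothing booked; BSD is not proved by this.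

WHY. For the seven `Δ_cubic > 0` rows of the additive census the point field `E = ℚ(P)` is a TOTALLY REAL cubic; the honest carrier of
statement (A) at `2` is the CM sextic `F = E(√−1)` (cruxlead-19573-w2's door `PointFieldMu.exists_fineSelmerDualData_moduleFinite_of_classicalMu_pointField_adjoin`,
p718233, takes `μ₂(F^{cyc}) = 0` as ONLY input), but `h(F)` is EVEN there (the narrow defect of `E` is positive: a totally positive
non-square unit), so Iwasawa 1956 is void, and the Kida-lite ascents need `≤ 1` real place. The two-layer Horie–Fukuda criterion
(`Literature/NumberTheory/IwasawaTheory/ClassicalMuVanishesAdjoinIOfNarrowDefectLayerOne.lean`, this seat): `rank₂ Cl(F_n) = ord₂ h⁺(E_n) − ord₂ h(E_n)`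
(Horie 1994 Lemma 1 (ii)) along `F·ℚ_∞`, so `#(U⁺/U²)(E·ℚ_1) = #(U⁺/U²)(E)` makes the `2`-ranks of layers `0, 1` agree and Fukuda
1994 Thm. 1 (2) (kernel) gives `μ₂(F^{cyc}) = 0`.

* `conjA_two_of_pointField_of_card_totPosUnitsModSq_layer_one_eq` — `W/ℚ` elliptic, `P ∈ W[2] ∖ 0`, `ℚ̄^{Stab P} = E` totally real
  of odd degree, `h(E)` odd, one prime above `2`, `#(U⁺/U²)(E ⊔ ℚ_1) = #(U⁺/U²)(E)` ⟹ (A)₂ at `W` (`∃ γ D`).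
* `conjA_two_of_adjoin_root_of_card_totPosUnitsModSq_layer_one_eq` — the cubic currency `E = ℚ(θ)`, `θ` a root of `X³ + pX² + qX + r`.

References: [Horie1994] Lemma 1 (ii); [Fukuda1994] Thm. 1 (2); [CoatesSujatha2005] Conj. A, Thm. 3.4; [Lim2017FineSelmer] Thm. 3.5 (context);
tree p718233, p735978, p736268, p737179.
-/

set_option autoImplicit false
-- sibling precedent: the directory name repeats the summit name
set_option linter.dupNamespace false

noncomputable section

open scoped Classical IntermediateField NumberField

namespace Summit.BirchSwinnertonDyer.BirchSwinnertonDyer.Theorems.AddKatoTwo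

open WeierstrassCurve Field Polynomial IsDedekindDomain NumberField Literature.NumberTheory.EllipticCurves
  Literature.NumberTheory.GaloisRepresentations
  Literature.NumberTheory.IwasawaTheory Literature.NumberTheory.NumberFields
  Literature.Geometry.Kaehler.ComplexTorus
  Summit.BirchSwinnertonDyer.BirchSwinnertonDyer.Theorems.SteinbergFibreAtTwo
  Summit.BirchSwinnertonDyer.BirchSwinnertonDyer.Theorems.AlignedTransportAtTwoTorsionPointField

/-- **THE NARROW-DEFECT DOOR.** `W/ℚ` elliptic, `P ∈ W[2] ∖ 0` with point field `ℚ̄^{Stab P} = E`, `E ⊆ ℚ̄` TOTALLY REAL of odd degree,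
`h(E)` odd, exactly one prime of `E` above `2`; `ℚ_1 = ℚ(√2)` the first layer of the cyclotomic `ℤ₂`-extension of `ℚ`. If
`#(U⁺/U²)(E ⊔ ℚ_1) = #(U⁺/U²)(E)` then statement (A) holds at `(W, 2)`: for every cyclotomic `ℤ₂`-extension of `ℚ` some fine Selmer dual
datum of `W` over `ℚ_∞` is finitely generated over `ℤ₂`. KERNEL: `μ₂ = 0` for the CM carrier `E(√−1)` by the two-layer Horie–Fukuda criterion
(`classicalMuVanishes_sup_adjoin_of_card_totPosUnitsModSq_layer_one_eq`), then cruxlead-19573-w2's unipotent-dévissage door (p718233).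
NO Lim 2017 fact, NO Ferrero–Washington. [cite: Horie1994, §1 Lemma 1 (ii)] [cite: Fukuda1994, Thm. 1 (2), p. 264]
[cite: CoatesSujatha2005, Conj. A and Thm. 3.4] -/
theorem conjA_two_of_pointField_of_card_totPosUnitsModSq_layer_one_eq (W : WeierstrassCurve ℚ) [W.IsElliptic]
    {P : geomTorsion W 2} (hP : P ≠ 0) (E : IntermediateField ℚ (AlgebraicClosure ℚ)) [FiniteDimensional ℚ E] [IsTotallyReal E]
    (hF : IntermediateField.fixedField (MulAction.stabilizer (absoluteGaloisGroup ℚ) P) = E)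
    (hE : Odd (Module.finrank ℚ E)) (hh : haveI : NumberField E := NumberField.mk; Odd (classNumber E))
    (h2 : ∃! v : HeightOneSpectrum (𝓞 E), ((2 : ℕ) : 𝓞 E) ∈ v.asIdeal)
    (hδ : haveI : FiniteDimensional ℚ ↥((CyclotomicZp.zpExtension 2).layer 1) :=
        (CyclotomicZp.zpExtension 2).finiteDimensional_layer_holds 1
      haveI : NumberField ↥(E ⊔ (CyclotomicZp.zpExtension 2).layer 1) := NumberField.mk
      haveI : NumberField E := NumberField.mk
      Nat.card (TotPosUnitsModSq ↥(E ⊔ (CyclotomicZp.zpExtension 2).layer 1)) = Nat.card (TotPosUnitsModSq E))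
    (κ : ZpExtension ℚ 2) (hκ : κ.IsCyclotomic) :
    ∃ (γ : absoluteGaloisGroup ℚ) (D : W.FineSelmerDualData κ γ),
      Module.Finite ℤ_[2] (RestrictScalars ℤ_[2] (IwasawaAlgebra 2) D.X) := by
  obtain ⟨i, hi⟩ := IsAlgClosed.exists_pow_nat_eq (-1 : AlgebraicClosure ℚ) two_pos
  subst hF
  exact PointFieldMu.exists_fineSelmerDualData_moduleFinite_of_classicalMu_pointField_adjoin W hP hi
    (fun κF hκF => classicalMuVanishes_sup_adjoin_of_card_totPosUnitsModSq_layer_one_eq _ hE hh h2 hi hδ κF hκF) κ hκ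

section Cubic

variable {p q r : ℤ}

/-- **THE NARROW-DEFECT DOOR IN THE CUBIC CURRENCY.** `W/ℚ` elliptic, `P ∈ W[2] ∖ 0` with point field `ℚ̄^{Stab P} = ℚ(θ)`, `θ` a root
of `X³ + pX² + qX + r` with `[ℚ(θ):ℚ] = 3`, `ℚ(θ)` totally real, `2 ∤ #Cl(𝓞 ℚ(θ))`, exactly one prime above `2`, and
`#(U⁺/U²)(ℚ(θ) ⊔ ℚ_1) = #(U⁺/U²)(ℚ(θ))` ⟹ (A)₂ at `W`. The per-row input is a finite UNIT-SIGNATURE certificate for `ℚ(θ)` and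
`ℚ(θ, √2)` (`ℚ_1 ∋ √2`). [cite: Horie1994, §1 Lemma 1 (ii)] [cite: Fukuda1994, Thm. 1 (2), p. 264] [cite: CoatesSujatha2005, Conj. A and Thm. 3.4] -/
theorem conjA_two_of_adjoin_root_of_card_totPosUnitsModSq_layer_one_eq (W : WeierstrassCurve ℚ) [W.IsElliptic]
    {P : geomTorsion W 2} (hP : P ≠ 0) {θ : AlgebraicClosure ℚ} (hθ : aeval θ (Cubic.toPoly ⟨1, (p : ℚ), q, r⟩) = 0)
    (h3 : Module.finrank ℚ ↥ℚ⟮θ⟯ = 3)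
    (hF : IntermediateField.fixedField (MulAction.stabilizer (absoluteGaloisGroup ℚ) P) = ℚ⟮θ⟯)
    [IsTotallyReal ↥ℚ⟮θ⟯]
    (hh : ¬ 2 ∣ Nat.card (ClassGroup (𝓞 ↥ℚ⟮θ⟯)))
    (hv : ∃! v : HeightOneSpectrum (𝓞 ↥ℚ⟮θ⟯), ((2 : ℕ) : 𝓞 ↥ℚ⟮θ⟯) ∈ v.asIdeal)
    (hδ : haveI : FiniteDimensional ℚ ↥ℚ⟮θ⟯ :=
        IntermediateField.adjoin.finiteDimensional ⟨_, Cubic.monic_of_a_eq_one', by rwa [← aeval_def]⟩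
      haveI : FiniteDimensional ℚ ↥((CyclotomicZp.zpExtension 2).layer 1) :=
        (CyclotomicZp.zpExtension 2).finiteDimensional_layer_holds 1
      haveI : NumberField ↥(ℚ⟮θ⟯ ⊔ (CyclotomicZp.zpExtension 2).layer 1) := NumberField.mk
      haveI : NumberField ↥ℚ⟮θ⟯ := NumberField.mk
      Nat.card (TotPosUnitsModSq ↥(ℚ⟮θ⟯ ⊔ (CyclotomicZp.zpExtension 2).layer 1)) = Nat.card (TotPosUnitsModSq ↥ℚ⟮θ⟯))
    (κ : ZpExtension ℚ 2) (hκ : κ.IsCyclotomic) :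
    ∃ (γ : absoluteGaloisGroup ℚ) (D : W.FineSelmerDualData κ γ),
      Module.Finite ℤ_[2] (RestrictScalars ℤ_[2] (IwasawaAlgebra 2) D.X) := by
  have hfm : (Cubic.toPoly ⟨1, (p : ℚ), q, r⟩).Monic := Cubic.monic_of_a_eq_one'
  have hθint : IsIntegral ℚ θ := ⟨_, hfm, by rwa [← aeval_def]⟩
  haveI : FiniteDimensional ℚ ↥ℚ⟮θ⟯ := IntermediateField.adjoin.finiteDimensional hθint
  haveI : NumberField ↥ℚ⟮θ⟯ := NumberField.mk
  have hodd3 : Odd (Module.finrank ℚ ↥ℚ⟮θ⟯) := by rw [h3]; decide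
  have hh' : Odd (classNumber ↥ℚ⟮θ⟯) := by
    rw [NumberField.classNumber, ← Nat.card_eq_fintype_card]
    exact Nat.odd_iff.mpr (Nat.two_dvd_ne_zero.mp hh)
  exact conjA_two_of_pointField_of_card_totPosUnitsModSq_layer_one_eq W hP ℚ⟮θ⟯ hF hodd3 hh' hv hδ κ hκ

end Cubic

end Summit.BirchSwinnertonDyer.BirchSwinnertonDyer.Theorems.AddKatoTwo

end
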